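import Summits.QuantumFields.BalabanUV.Beta.GAN24.Push3
import Summits.QuantumFields.BalabanUV.Beta.GAN24.ThirdJetKernel

/-!
# `BalabanUV.Beta.GAN24.SrecLinearPartEq` — binder row G-an2-4 / (CONV-C), S-slot road «SREC» (row owner gan24-p1-g12's `SKELETON-SREC.md` v0.2 SR-L1;
# RULINGS-15 (R15-2) «SREC-LIN»): THE THIRD-JET FUNCTIONAL `ThirdJetKernel.e3K K L S` IS A SUM OF FOUR THREE-LEG PUSHES — one per fibre channel of the
# stencil family — and ONE push for ff-valued families (the `K`-free form of the linear part of the (E) recursion's cubic line)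

NOT IN PRINT; OUR BOOKKEEPING (G-an2-4 formalisation swarm, leaf prover `b2b-balaban-gan24-formalise-leaf-01`, gen 43; the row owner's RULINGS-15 (R15-2)
invitation, journal `CLAIMS.log` l.17352, claim l.17729; names PROVISIONAL — the owner may rename / re-cut).  HONEST FRAMING (cell contract, verbatim):
«discharging `BetaPertH` makes Bałaban's UV stability UNCONDITIONAL — a real constructive-QFT result; it is NOT the continuum limit and NOT the Clay problem.»
HONEST DEPENDENCY (verbatim): «continuum YM on T⁴ ⇐ BetaPertH ∧ nine spine estimates (0/9 proved); BetaPertH ⇐ (D1) ∧ (D4) ∧ CAP+tail; G-an2-4 gates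
asym, D1 and NE2/3/4.»

WHAT.  `e3K K L S κ′ u′ = −mmRead L (K ∘ vertexOfK K L S κ′ u′ ∘ K)` (leaf-05's `ThirdJetKernel.e3K`; the cubic line of an2's `SrecAt` recursion is
`(cE·wE) • e3K (coDressKBmAt ρ Lc (KInvStep Lc j)) Lc (SrecAt … j)`, in units `(cE·Lc^{2(d+1)}) • e3K (KStepUnit Lc j) Lc (𝔇 S̃_j)` — the owner's
`SrecUnits.unitS_SrecAt_succ_cubic`).  The `mm`-read of the sandwich sees the kernel `K` through FOUR leg families — at the coarse multiplier row `(L•x′, inr α)`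
the fine index is a field index (`Push4.rowM K L`) or a multiplier index (`rowMM K L`, new); at the coarse multiplier column `(L•z′, inr β)` likewise
(`OneStepKernelFamily.colH K L` ∕ `colM K L`, new) — and the table leg through `colH K L` (`vertexOfK = vertexW (colH K L)`, leaf-17 by `rfl`).  Which pair of
kernel legs is read is decided by the FIBRE CHANNEL of the stencil entry `S κ u x z a b` (`a`, `b` field or multiplier; my lineage's `E3UnitSplit.e3OfS_ff/_fm/_mf`
channel split for `KInv`): the V–H border stencil of the literal HAS a field–multiplier channel (`AveragingWardRootedStencils.divV_vhSAt_inl_inr`), so the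
ff-valued read identity of `Push3` §3 is not the whole story for road «SREC».  This module proves, for a DECAYING kernel and a LOCAL stencil family (the two
`tsum` splits need summability — nothing else does):
* §1 the multiplier-slot leg families `colM K N β z′ μ z := K z (N•z′) (inr μ) (inr β)`, `rowMM K N α x′ μ x := K (N•x′) x (inr α) (inr μ)` and their
  `LegDecay` from `Decays K` (beside leaf-17's `legDecay_rowM` / `legDecay_colH`);
* §2 the CHANNEL RE-SLOTTING `reslot σ τ S` (the `(σ κ₁, τ κ₂)` entries of each `S κ u` moved to the ff block, everything else `0`; `σ, τ ∈ {Sum.inl, Sum.inr}`):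
  ff-valued, `LocStencil` preserved, `reslot inl inl S = S` and the three mixed re-slottings vanish for ff-valued `S`; `vertexW_reslot`; `push₃_zero`;
* §3 **THE FOUR-CHANNEL READ IDENTITY** `e3K_eq_neg_sum_push₃`: `Decays K C m`, `0 < m`, `LocStencil S Cs δ`, `0 < δ` ⟹
  `e3K K L S κ′ u′ = −(push₃ (rowM K L) (colH K L) (colH K L) (reslot inl inl S) + push₃ (rowM K L) (colM K L) (colH K L) (reslot inl inr S)
  + push₃ (rowMM K L) (colH K L) (colH K L) (reslot inr inl S) + push₃ (rowMM K L) (colM K L) (colH K L) (reslot inr inr S)) κ′ u′`;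
* §4 the ff-VALUED case `e3K_eq_neg_push₃_of_isFF`: `e3K K L S κ′ u′ = −push₃ (rowM K L) (colH K L) (colH K L) S κ′ u′` — HYPOTHESIS-FREE in `K` and `S`
  (leaf-01's `Push3.neg_mmRead_sandwich_vertexOfK_eq_push₃`; the owner's wished one-line corollary, ACK l.17636);
* §5 consequence: **`e3K_add`** — `S ↦ e3K K L S κ′ u′` is ADDITIVE on the class of local stencil families (decaying `K`) = the «additive on a class»
  hypothesis of leaf-01's `AffineUnroll` for the linear maps of the cubic line (`reslot_add` + `Push3.push₃_add` per channel).
[folklore] throughout: three plumbing `def`s (`colM`, `rowMM`, `reslot`), finite-sum / dominated-`tsum` bookkeeping; 0 cited facts, 0 `def … : Prop`, 0 sorry.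
Asserts NO shape of Bałaban's stencils; the instantiation at the dressed literal (the co-dressed `KStepUnit`, the owner's `SrecUnits*`; the dressed leg
families = row V1-d `RespStepBm`) is NOT done here; discharges NOTHING of (hS, hSall) on (E); 0 wall binders; NEVER «G-an2-4 closed»; NOT D1, NOT BetaPertH,
NOT continuum, NOT Clay.
-/

noncomputable section

open Finset
open scoped BigOperators
open Literature.MathematicalPhysics.QuantumFieldTheory
open Literature.MathematicalPhysics.QuantumFieldTheory.Balaban1983to89
open Literature.MathematicalPhysics.QuantumFieldTheory.Balaban1983to89.Beta
open B12Sec2to5 (l1 l1_nonneg)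
open ExpKernelCalculus (MKer Decays BiLoc comp Zl Zl_nonneg l1_sub_symm summable_exp_shift summable_exp_shift' tsum_exp_shift tsum_exp_shift')
open OneStepResolventKernel (Fib wsum LocStencil)
open OneStepKernelFamily (colH vertexOfK)
open BalabanStepJetsSucc (mmRead)
open KKTFluctuationEnergy (summable_mul_of_bdd summable_mul_of_bdd')
open Summit.QuantumFields.BalabanUV.Beta.GAN24.Push4 (rowM rowM_apply colH_apply' vertexW vertexW_apply vertexOfK_eq_vertexW Lk Rk ffRead IsFF
  isFF_ffRead Lk_inl_inl Lk_inl_inr Lk_inr Rk_inl_inl Rk_inr_left Rk_inr_right ffRead_inl_inl ffRead_inr_left ffRead_inr_right)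
open Summit.QuantumFields.BalabanUV.Beta.GAN24.Push4Bounds (LegDecay LegDecay.nonneg LegDecay.abs_le legDecay_colH legDecay_rowM)
open Summit.QuantumFields.BalabanUV.Beta.GAN24.Push4NestAux (decays_vertexW_of_locStencil abs_le_of_decays)
open Summit.QuantumFields.BalabanUV.Beta.GAN24.Push3 (push₃ push₃_def push₃_inl_inl push₃_inr_left push₃_inr_right push₃_neg push₃_add
  neg_mmRead_sandwich_vertexOfK_eq_push₃)
open Summit.QuantumFields.BalabanUV.Beta.GAN24.ThirdJetKernel (e3K e3K_inl_inl e3K_inr_left e3K_inr_right)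

namespace Summit.QuantumFields.BalabanUV.Beta.GAN24.SrecLinearPartEq

variable {d : ℕ}

/-! ## §1 The multiplier-slot leg families of a packed kernel -/

/-- [our object] **THE mm-COLUMN FAMILY** of a packed kernel at blocking `N`: `colM K N β z′ μ z := K z (N•z′) (inr μ) (inr β)` — the weight with which the
RIGHT kernel leg of the sandwich, read at the coarse multiplier point `(N•z′, β)`, sees a fine MULTIPLIER index `(z, μ)` of the middle kernel (the companion
of an4's `colH K N β z′ κ z = K z (N•z′) (inl κ) (inr β)`, which sees the fine FIELD indices). -/
def colM (K : MKer (d + 1) (Fib d)) (N : ℕ) (β : Fin (d + 1)) (z' : Fin (d + 1) → ℤ) (μ : Fin (d + 1)) (z : Fin (d + 1) → ℤ) : ℝ :=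
  K z ((N : ℤ) • z') (Sum.inr μ) (Sum.inr β)

/-- [our object] **THE mm-ROW FAMILY** of a packed kernel at blocking `N`: `rowMM K N α x′ μ x := K (N•x′) x (inr α) (inr μ)` (the companion of leaf-17's
`rowM K N α x′ κ x = K (N•x′) x (inr α) (inl κ)`). -/
def rowMM (K : MKer (d + 1) (Fib d)) (N : ℕ) (α : Fin (d + 1)) (x' : Fin (d + 1) → ℤ) (μ : Fin (d + 1)) (x : Fin (d + 1) → ℤ) : ℝ :=
  K ((N : ℤ) • x') x (Sum.inr α) (Sum.inr μ)

/-- [folklore] `colM`, by `rfl`. -/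
@[simp] theorem colM_apply (K : MKer (d + 1) (Fib d)) (N : ℕ) (β : Fin (d + 1)) (z' : Fin (d + 1) → ℤ) (μ : Fin (d + 1))
    (z : Fin (d + 1) → ℤ) : colM K N β z' μ z = K z ((N : ℤ) • z') (Sum.inr μ) (Sum.inr β) := rfl

/-- [folklore] `rowMM`, by `rfl`. -/
@[simp] theorem rowMM_apply (K : MKer (d + 1) (Fib d)) (N : ℕ) (α : Fin (d + 1)) (x' : Fin (d + 1) → ℤ) (μ : Fin (d + 1))
    (x : Fin (d + 1) → ℤ) : rowMM K N α x' μ x = K ((N : ℤ) • x') x (Sum.inr α) (Sum.inr μ) := rfl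

variable {N : ℕ} {C m : ℝ}

/-- [folklore] The mm-column family of a decaying kernel is a localised leg family. -/
theorem legDecay_colM {K : MKer (d + 1) (Fib d)} (hK : Decays K C m) : LegDecay (colM K N) N C m :=
  fun _ _ _ _ => hK _ _ _ _

/-- [folklore] The mm-row family of a decaying kernel is a localised leg family. -/
theorem legDecay_rowMM {K : MKer (d + 1) (Fib d)} (hK : Decays K C m) : LegDecay (rowMM K N) N C m := by
  intro α x' μ x
  rw [rowMM_apply, l1_sub_symm]
  exact hK _ _ _ _

/-! ## §2 Channel re-slotting of a stencil family -/

/-- [our object] **CHANNEL RE-SLOTTING**: the `(σ κ₁, τ κ₂)` fibre entries of every member `S κ u` moved to the field–field block `(inl κ₁, inl κ₂)`, all other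
entries `0` (`σ, τ ∈ {Sum.inl, Sum.inr}` pick the channel: `reslot inl inr S` is the field–multiplier channel of `S` read as an ff-valued family, etc.). -/
def reslot (σ τ : Fin (d + 1) → Fib d) (S : Fin (d + 1) → (Fin (d + 1) → ℤ) → MKer (d + 1) (Fib d)) :
    Fin (d + 1) → (Fin (d + 1) → ℤ) → MKer (d + 1) (Fib d) :=
  fun κ u x z a b =>
    match a, b with
    | Sum.inl κ₁, Sum.inl κ₂ => S κ u x z (σ κ₁) (τ κ₂)
    | Sum.inl _, Sum.inr _ => 0
    | Sum.inr _, Sum.inl _ => 0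
    | Sum.inr _, Sum.inr _ => 0

variable (σ τ : Fin (d + 1) → Fib d) (S : Fin (d + 1) → (Fin (d + 1) → ℤ) → MKer (d + 1) (Fib d))

/-- [folklore] `reslot`: the ff entries are the chosen channel. -/
@[simp] theorem reslot_inl_inl (κ : Fin (d + 1)) (u x z : Fin (d + 1) → ℤ) (κ₁ κ₂ : Fin (d + 1)) :
    reslot σ τ S κ u x z (Sum.inl κ₁) (Sum.inl κ₂) = S κ u x z (σ κ₁) (τ κ₂) := rfl

/-- [folklore] `reslot`: multiplier rows vanish. -/
@[simp] theorem reslot_inr_left (κ : Fin (d + 1)) (u x z : Fin (d + 1) → ℤ) (μ : Fin (d + 1)) (b : Fib d) :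
    reslot σ τ S κ u x z (Sum.inr μ) b = 0 := by
  cases b <;> rfl

/-- [folklore] `reslot`: multiplier columns vanish. -/
@[simp] theorem reslot_inr_right (κ : Fin (d + 1)) (u x z : Fin (d + 1) → ℤ) (a : Fib d) (ν : Fin (d + 1)) :
    reslot σ τ S κ u x z a (Sum.inr ν) = 0 := by
  cases a <;> rfl

/-- [folklore] Every re-slotted family is ff-valued. -/
theorem isFF_reslot (κ : Fin (d + 1)) (u : Fin (d + 1) → ℤ) : IsFF (reslot σ τ S κ u) :=
  ⟨fun x z μ b => reslot_inr_left σ τ S κ u x z μ b, fun x z a ν => reslot_inr_right σ τ S κ u x z a ν⟩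

variable {σ τ S}

/-- [folklore] Re-slotting preserves `LocStencil` (same constant, same rate: entries are entries of `S` or `0`). -/
theorem locStencil_reslot {Cs δ : ℝ} (hS : LocStencil S Cs δ) (σ τ : Fin (d + 1) → Fib d) : LocStencil (reslot σ τ S) Cs δ := by
  intro κ u x z a b
  have hCs : 0 ≤ Cs := (hS 0 0).nonneg (Sum.inl 0)
  rcases a with κ₁ | μ
  · rcases b with κ₂ | ν
    · rw [reslot_inl_inl]; exact hS κ u x z (σ κ₁) (τ κ₂)
    · rw [reslot_inr_right, abs_zero]; positivity
  · rw [reslot_inr_left, abs_zero]; positivity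

/-- [folklore] For an ff-valued family the ff re-slotting is the family itself. -/
theorem reslot_inl_inl_eq_self (hS : ∀ κ u, IsFF (S κ u)) : reslot Sum.inl Sum.inl S = S := by
  funext κ u x z a b
  rcases a with κ₁ | μ
  · rcases b with κ₂ | ν
    · rfl
    · rw [reslot_inr_right, (hS κ u).2]
  · rw [reslot_inr_left, (hS κ u).1]

/-- [folklore] For an ff-valued family the field–multiplier re-slotting vanishes. -/
theorem reslot_inl_inr_eq_zero (hS : ∀ κ u, IsFF (S κ u)) : reslot Sum.inl Sum.inr S = fun _ _ => 0 := by
  funext κ u x z a b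
  rcases a with κ₁ | μ
  · rcases b with κ₂ | ν
    · rw [reslot_inl_inl, (hS κ u).2]; rfl
    · rw [reslot_inr_right]; rfl
  · rw [reslot_inr_left]; rfl

/-- [folklore] For an ff-valued family the multiplier–field re-slotting vanishes. -/
theorem reslot_inr_inl_eq_zero (hS : ∀ κ u, IsFF (S κ u)) : reslot Sum.inr Sum.inl S = fun _ _ => 0 := by
  funext κ u x z a b
  rcases a with κ₁ | μ
  · rcases b with κ₂ | ν
    · rw [reslot_inl_inl, (hS κ u).1]; rfl
    · rw [reslot_inr_right]; rfl
  · rw [reslot_inr_left]; rfl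

/-- [folklore] For an ff-valued family the multiplier–multiplier re-slotting vanishes. -/
theorem reslot_inr_inr_eq_zero (hS : ∀ κ u, IsFF (S κ u)) : reslot Sum.inr Sum.inr S = fun _ _ => 0 := by
  funext κ u x z a b
  rcases a with κ₁ | μ
  · rcases b with κ₂ | ν
    · rw [reslot_inl_inl, (hS κ u).1]; rfl
    · rw [reslot_inr_right]; rfl
  · rw [reslot_inr_left]; rfl

/-- [folklore] **THE TABLE VERTEX OF A RE-SLOTTED FAMILY IS THE RE-SLOTTED TABLE VERTEX** (no hypothesis: the weights act on the table index only). -/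
theorem vertexW_reslot (w : Fin (d + 1) → (Fin (d + 1) → ℤ) → Fin (d + 1) → (Fin (d + 1) → ℤ) → ℝ) (κ' : Fin (d + 1))
    (u' x z : Fin (d + 1) → ℤ) (κ₁ κ₂ : Fin (d + 1)) :
    vertexW w (reslot σ τ S) κ' u' x z (Sum.inl κ₁) (Sum.inl κ₂) = vertexW w S κ' u' x z (σ κ₁) (τ κ₂) := by
  simp only [vertexW_apply, reslot_inl_inl]

/-- [folklore] The push of the zero family vanishes (no hypothesis). -/
theorem push₃_zero (l r w : Fin (d + 1) → (Fin (d + 1) → ℤ) → Fin (d + 1) → (Fin (d + 1) → ℤ) → ℝ) (κ' : Fin (d + 1))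
    (u' : Fin (d + 1) → ℤ) :
    push₃ l r w (fun (_ : Fin (d + 1)) (_ : Fin (d + 1) → ℤ) => (0 : MKer (d + 1) (Fib d))) κ' u' = 0 := by
  have h := push₃_neg l r w (fun (_ : Fin (d + 1)) (_ : Fin (d + 1) → ℤ) => (0 : MKer (d + 1) (Fib d))) κ' u'
  simp only [neg_zero] at h
  -- `h : P = -P`
  have h2 : (2 : ℝ) • push₃ l r w (fun (_ : Fin (d + 1)) (_ : Fin (d + 1) → ℤ) => (0 : MKer (d + 1) (Fib d))) κ' u' = 0 := by
    rw [two_smul]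
    nth_rewrite 2 [h]
    exact add_neg_cancel _
  exact (smul_eq_zero.mp h2).resolve_left two_ne_zero

/-! ## §3 THE FOUR-CHANNEL READ IDENTITY -/

section Read

variable {K : MKer (d + 1) (Fib d)} {L : ℕ} {Cs δ : ℝ}

/-- [folklore] Rows of a decaying kernel are summable. -/
theorem summable_row_of_decays (hK : Decays K C m) (hm : 0 < m) (p : Fin (d + 1) → ℤ) (a f : Fib d) :
    Summable fun x => K p x a f := by
  refine Summable.of_norm_bounded ((summable_exp_shift hm p).mul_left C) (fun x => ?_)
  rw [Real.norm_eq_abs]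
  exact hK p x a f

/-- [folklore] Columns of a decaying kernel are summable. -/
theorem summable_col_of_decays (hK : Decays K C m) (hm : 0 < m) (q : Fin (d + 1) → ℤ) (g b : Fib d) :
    Summable fun y => K y q g b := by
  refine Summable.of_norm_bounded ((summable_exp_shift' hm q).mul_left C) (fun y => ?_)
  rw [Real.norm_eq_abs]
  exact hK y q g b

/-- [folklore] A row of a decaying kernel against a bounded middle kernel, summed over ONE fibre channel `σ`, is bounded by `(d+1)·C·C_W·Zl m`. -/
theorem abs_tsum_row_mul_le (hK : Decays K C m) (hm : 0 < m) {W : MKer (d + 1) (Fib d)} {CW : ℝ} (hW : ∀ x y f g, |W x y f g| ≤ CW)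
    (σ : Fin (d + 1) → Fib d) (p y : Fin (d + 1) → ℤ) (a g : Fib d) :
    |∑' x, ∑ κ, K p x a (σ κ) * W x y (σ κ) g| ≤ (d + 1 : ℕ) * (C * CW * Zl (d + 1) m) := by
  have hC : 0 ≤ C := hK.nonneg (Sum.inl 0)
  have hCW : 0 ≤ CW := (abs_nonneg _).trans (hW 0 0 (Sum.inl 0) (Sum.inl 0))
  have hpt : ∀ x, |∑ κ, K p x a (σ κ) * W x y (σ κ) g| ≤ (d + 1 : ℕ) * (C * CW) * Real.exp (-m * l1 (p - x)) := by
    intro x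
    calc |∑ κ, K p x a (σ κ) * W x y (σ κ) g| ≤ ∑ κ, |K p x a (σ κ) * W x y (σ κ) g| := Finset.abs_sum_le_sum_abs _ _
      _ ≤ ∑ _κ : Fin (d + 1), C * Real.exp (-m * l1 (p - x)) * CW := Finset.sum_le_sum fun κ _ => by
          rw [abs_mul]; exact mul_le_mul (hK p x a (σ κ)) (hW x y (σ κ) g) (abs_nonneg _) (by positivity)
      _ = _ := by rw [Finset.sum_const, Finset.card_univ, Fintype.card_fin, nsmul_eq_mul]; ring
  have hs := (summable_exp_shift hm p).mul_left ((d + 1 : ℕ) * (C * CW))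
  have hb := tsum_of_norm_bounded hs.hasSum (fun x => by rw [Real.norm_eq_abs]; exact hpt x)
  rw [Real.norm_eq_abs] at hb
  refine hb.trans (le_of_eq ?_)
  rw [tsum_mul_left, tsum_exp_shift]
  ring

/-- [folklore] The same slice is summable. -/
theorem summable_row_mul (hK : Decays K C m) (hm : 0 < m) {W : MKer (d + 1) (Fib d)} {CW : ℝ} (hW : ∀ x y f g, |W x y f g| ≤ CW)
    (σ : Fin (d + 1) → Fib d) (p y : Fin (d + 1) → ℤ) (a g : Fib d) :
    Summable fun x => ∑ κ, K p x a (σ κ) * W x y (σ κ) g :=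
  summable_sum fun κ _ => summable_mul_of_bdd' (summable_row_of_decays hK hm p a (σ κ)) (fun x => hW x y (σ κ) g)

/-- [folklore] **THE FOUR-CHANNEL READ IDENTITY.**  For a DECAYING packed kernel `K` (`Decays K C m`, `0 < m`), any blocking `L`, and a LOCAL stencil family
`S` (`LocStencil S Cs δ`, `0 < δ`), the third-jet functional is minus the sum of four three-leg pushes, one per fibre channel of the stencil entries:
`e3K K L S κ′ u′ = −(push₃ (rowM K L) (colH K L) (colH K L) (reslot inl inl S) + push₃ (rowM K L) (colM K L) (colH K L) (reslot inl inr S)`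
`+ push₃ (rowMM K L) (colH K L) (colH K L) (reslot inr inl S) + push₃ (rowMM K L) (colM K L) (colH K L) (reslot inr inr S)) κ′ u′`.
The table leg is `colH K L` in all four (an4's `vertexOfK = vertexW (colH K L)`); the left/right KERNEL legs are the mf-row `rowM` or mm-row `rowMM` and
the `ℋ`-column `colH` or mm-column `colM` according to the channel.  (Decay and locality serve ONLY to split the two `tsum`s of the sandwich.) -/
theorem e3K_eq_neg_sum_push₃ (hK : Decays K C m) (hm : 0 < m) (L : ℕ) {S : Fin (d + 1) → (Fin (d + 1) → ℤ) → MKer (d + 1) (Fib d)}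
    (hS : LocStencil S Cs δ) (hδ : 0 < δ) (κ' : Fin (d + 1)) (u' : Fin (d + 1) → ℤ) :
    e3K K L S κ' u'
      = -(push₃ (rowM K L) (colH K L) (colH K L) (reslot Sum.inl Sum.inl S) κ' u'
          + push₃ (rowM K L) (colM K L) (colH K L) (reslot Sum.inl Sum.inr S) κ' u'
          + push₃ (rowMM K L) (colH K L) (colH K L) (reslot Sum.inr Sum.inl S) κ' u'
          + push₃ (rowMM K L) (colM K L) (colH K L) (reslot Sum.inr Sum.inr S) κ' u') := by
  -- data
  have hC : 0 ≤ C := hK.nonneg (Sum.inl 0)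
  have hcolb : ∀ μ y κ u, |colH K L μ y κ u| ≤ C := fun μ y κ u => (legDecay_colH hK).abs_le hm.le μ y κ u
  -- the middle kernel `W := vertexW (colH K L) S κ′ u′ = vertexOfK K L S κ′ u′` decays, hence is bounded
  set W : MKer (d + 1) (Fib d) := vertexW (colH K L) S κ' u' with hWdef
  have hVW : vertexOfK K L S κ' u' = W := by rw [vertexOfK_eq_vertexW]
  have hWdec : Decays W ((d + 1 : ℕ) * (C * Cs * Zl (d + 1) (δ / 2))) (δ / 2) := decays_vertexW_of_locStencil hcolb hC hS hδ κ' u'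
  have hWb : ∀ x y f g, |W x y f g| ≤ (d + 1 : ℕ) * (C * Cs * Zl (d + 1) (δ / 2)) := fun x y f g =>
    abs_le_of_decays hWdec (half_pos hδ).le x y f g
  funext x' z' a b
  rcases a with α | μ₀
  · rcases b with β | ν₀
    · -- the field–field entry
      simp only [Pi.neg_apply, Pi.add_apply]
      rw [e3K_inl_inl, hVW, push₃_inl_inl, push₃_inl_inl, push₃_inl_inl, push₃_inl_inl]
      simp only [rowM_apply, colH_apply', colM_apply, rowMM_apply, vertexW_reslot, ← hWdef]
      congr 1
      set p : Fin (d + 1) → ℤ := (L : ℤ) • x' with hp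
      set q : Fin (d + 1) → ℤ := (L : ℤ) • z' with hq
      -- the two channel parts of the inner composition
      set A₁ : (Fin (d + 1) → ℤ) → Fib d → ℝ := fun y g => ∑' x, ∑ κ, K p x (Sum.inr α) (Sum.inl κ) * W x y (Sum.inl κ) g with hA₁
      set A₂ : (Fin (d + 1) → ℤ) → Fib d → ℝ := fun y g => ∑' x, ∑ μ, K p x (Sum.inr α) (Sum.inr μ) * W x y (Sum.inr μ) g with hA₂
      have hA : ∀ y g, (∑' x, ∑ f, K p x (Sum.inr α) f * W x y f g) = A₁ y g + A₂ y g := by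
        intro y g
        rw [hA₁, hA₂, ← (summable_row_mul hK hm hWb Sum.inl p y (Sum.inr α) g).tsum_add
          (summable_row_mul hK hm hWb Sum.inr p y (Sum.inr α) g)]
        exact tsum_congr fun x => Fintype.sum_sum_type _
      have hA₁b : ∀ y g, |A₁ y g| ≤ (d + 1 : ℕ) * (C * ((d + 1 : ℕ) * (C * Cs * Zl (d + 1) (δ / 2))) * Zl (d + 1) m) :=
        fun y g => abs_tsum_row_mul_le hK hm hWb Sum.inl p y (Sum.inr α) g
      have hA₂b : ∀ y g, |A₂ y g| ≤ (d + 1 : ℕ) * (C * ((d + 1 : ℕ) * (C * Cs * Zl (d + 1) (δ / 2))) * Zl (d + 1) m) :=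
        fun y g => abs_tsum_row_mul_le hK hm hWb Sum.inr p y (Sum.inr α) g
      -- the four outer summands
      set T₁ : (Fin (d + 1) → ℤ) → ℝ := fun y => ∑ l', A₁ y (Sum.inl l') * K y q (Sum.inl l') (Sum.inr β) with hT₁
      set T₂ : (Fin (d + 1) → ℤ) → ℝ := fun y => ∑ μ', A₁ y (Sum.inr μ') * K y q (Sum.inr μ') (Sum.inr β) with hT₂
      set T₃ : (Fin (d + 1) → ℤ) → ℝ := fun y => ∑ l', A₂ y (Sum.inl l') * K y q (Sum.inl l') (Sum.inr β) with hT₃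
      set T₄ : (Fin (d + 1) → ℤ) → ℝ := fun y => ∑ μ', A₂ y (Sum.inr μ') * K y q (Sum.inr μ') (Sum.inr β) with hT₄
      have sT₁ : Summable T₁ := summable_sum fun l' _ =>
        summable_mul_of_bdd (fun y => hA₁b y (Sum.inl l')) (summable_col_of_decays hK hm q (Sum.inl l') (Sum.inr β))
      have sT₂ : Summable T₂ := summable_sum fun μ' _ =>
        summable_mul_of_bdd (fun y => hA₁b y (Sum.inr μ')) (summable_col_of_decays hK hm q (Sum.inr μ') (Sum.inr β))
      have sT₃ : Summable T₃ := summable_sum fun l' _ =>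
        summable_mul_of_bdd (fun y => hA₂b y (Sum.inl l')) (summable_col_of_decays hK hm q (Sum.inl l') (Sum.inr β))
      have sT₄ : Summable T₄ := summable_sum fun μ' _ =>
        summable_mul_of_bdd (fun y => hA₂b y (Sum.inr μ')) (summable_col_of_decays hK hm q (Sum.inr μ') (Sum.inr β))
      -- split
      simp only [comp]
      calc (∑' y, ∑ g, (∑' x, ∑ f, K p x (Sum.inr α) f * W x y f g) * K y q g (Sum.inr β))
          = ∑' y, (T₁ y + T₂ y + T₃ y + T₄ y) := tsum_congr fun y => by
            rw [Fintype.sum_sum_type]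
            simp only [hA, add_mul, Finset.sum_add_distrib, hT₁, hT₂, hT₃, hT₄]
            ring
        _ = (∑' y, T₁ y) + (∑' y, T₂ y) + (∑' y, T₃ y) + (∑' y, T₄ y) := by
            rw [((sT₁.add sT₂).add sT₃).tsum_add sT₄, (sT₁.add sT₂).tsum_add sT₃, sT₁.tsum_add sT₂]
        _ = _ := by rfl
    · simp only [e3K_inr_right, Pi.neg_apply, Pi.add_apply, push₃_inr_right, add_zero, neg_zero]
  · simp only [e3K_inr_left, Pi.neg_apply, Pi.add_apply, push₃_inr_left, add_zero, neg_zero]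

end Read

/-! ## §4 The ff-valued case: ONE push, hypothesis-free -/

/-- [folklore] **FOR AN ff-VALUED STENCIL FAMILY THE THIRD-JET FUNCTIONAL IS MINUS ONE THREE-LEG PUSH** — hypothesis-free in `K` and `S`
(no decay, no locality): `e3K K L S κ′ u′ = −push₃ (rowM K L) (colH K L) (colH K L) S κ′ u′` (leaf-01's `Push3.neg_mmRead_sandwich_vertexOfK_eq_push₃`
+ `push₃_neg`; the owner's one-line corollary, ACK l.17636 — with `colM := colH` on ff-valued families). -/
theorem e3K_eq_neg_push₃_of_isFF (K : MKer (d + 1) (Fib d)) (L : ℕ) {S : Fin (d + 1) → (Fin (d + 1) → ℤ) → MKer (d + 1) (Fib d)}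
    (hS : ∀ κ u, IsFF (S κ u)) (κ' : Fin (d + 1)) (u' : Fin (d + 1) → ℤ) :
    e3K K L S κ' u' = -push₃ (rowM K L) (colH K L) (colH K L) S κ' u' := by
  have h1 : e3K K L S κ' u' = -mmRead L (comp (comp K (vertexOfK K L S κ' u')) K) := by
    funext x z a b; rfl
  rw [h1, neg_mmRead_sandwich_vertexOfK_eq_push₃ K L hS, push₃_neg]

/-- [folklore] Consistency: for an ff-valued local family and a decaying kernel the four-channel identity collapses to the one-push form (the three
mixed channels are pushes of the zero family). -/
theorem e3K_eq_neg_push₃_of_isFF' {K : MKer (d + 1) (Fib d)} {C m Cs δ : ℝ} (hK : Decays K C m) (hm : 0 < m) (L : ℕ)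
    {S : Fin (d + 1) → (Fin (d + 1) → ℤ) → MKer (d + 1) (Fib d)} (hS : LocStencil S Cs δ) (hδ : 0 < δ) (hff : ∀ κ u, IsFF (S κ u))
    (κ' : Fin (d + 1)) (u' : Fin (d + 1) → ℤ) :
    e3K K L S κ' u' = -push₃ (rowM K L) (colH K L) (colH K L) S κ' u' := by
  rw [e3K_eq_neg_sum_push₃ hK hm L hS hδ, reslot_inl_inl_eq_self hff, reslot_inl_inr_eq_zero hff, reslot_inr_inl_eq_zero hff,
    reslot_inr_inr_eq_zero hff, push₃_zero, push₃_zero, push₃_zero, add_zero, add_zero, add_zero]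

/-! ## §5 Consequence: the third-jet functional is ADDITIVE on the class of local stencil families -/

/-- [folklore] Re-slotting is additive (pointwise; no hypothesis). -/
theorem reslot_add (σ τ : Fin (d + 1) → Fib d) (S S' : Fin (d + 1) → (Fin (d + 1) → ℤ) → MKer (d + 1) (Fib d)) :
    reslot σ τ (fun κ u => S κ u + S' κ u) = fun κ u => reslot σ τ S κ u + reslot σ τ S' κ u := by
  funext κ u x z a b
  rcases a with κ₁ | μ
  · rcases b with κ₂ | ν
    · simp only [reslot_inl_inl, Pi.add_apply]
    · simp only [reslot_inr_right, Pi.add_apply, add_zero]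
  · simp only [reslot_inr_left, Pi.add_apply, add_zero]

/-- [folklore] **`S ↦ e3K K L S κ′ u′` IS ADDITIVE ON THE CLASS OF LOCAL STENCIL FAMILIES** (decaying `K`; the two families local at positive rates):
`e3K K L (S + S′) κ′ u′ = e3K K L S κ′ u′ + e3K K L S′ κ′ u′` — the four-channel identity + leaf-01's `Push3.push₃_add` on each channel.  This is the
«additive on a class» hypothesis `hAadd` of leaf-01's `AffineUnroll` (`transport_add`, `eq_transport_add_sum`, `diff_succ`) for the linear maps of the (E)
recursion's cubic line. -/
theorem e3K_add {K : MKer (d + 1) (Fib d)} {C m : ℝ} (hK : Decays K C m) (hm : 0 < m) (L : ℕ)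
    {S S' : Fin (d + 1) → (Fin (d + 1) → ℤ) → MKer (d + 1) (Fib d)} {Cs Cs' δ δ' : ℝ} (hS : LocStencil S Cs δ) (hS' : LocStencil S' Cs' δ')
    (hδ : 0 < δ) (hδ' : 0 < δ') (κ' : Fin (d + 1)) (u' : Fin (d + 1) → ℤ) :
    e3K K L (fun κ u => S κ u + S' κ u) κ' u' = e3K K L S κ' u' + e3K K L S' κ' u' := by
  -- the sum is local at the smaller rate
  have hCs : 0 ≤ Cs := (hS 0 0).nonneg (Sum.inl 0)
  have hCs' : 0 ≤ Cs' := (hS' 0 0).nonneg (Sum.inl 0)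
  have hsum : LocStencil (fun κ u => S κ u + S' κ u) (Cs + Cs') (min δ δ') := by
    intro κ u x z a b
    show |(S κ u + S' κ u) x z a b| ≤ _
    simp only [Pi.add_apply]
    rw [add_mul]
    refine (abs_add_le _ _).trans (add_le_add ?_ ?_)
    · exact (hS κ u x z a b).trans (mul_le_mul_of_nonneg_left (Real.exp_le_exp.2 (by
        nlinarith [min_le_left δ δ', l1_nonneg (x - u), l1_nonneg (z - u)])) hCs)
    · exact (hS' κ u x z a b).trans (mul_le_mul_of_nonneg_left (Real.exp_le_exp.2 (by
        nlinarith [min_le_right δ δ', l1_nonneg (x - u), l1_nonneg (z - u)])) hCs')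
  have hl := legDecay_rowM (N := L) hK
  have hlm := legDecay_rowMM (N := L) hK
  have hr := legDecay_colH (N := L) hK
  have hrm := legDecay_colM (N := L) hK
  rw [e3K_eq_neg_sum_push₃ hK hm L hsum (lt_min hδ hδ') κ' u', e3K_eq_neg_sum_push₃ hK hm L hS hδ κ' u',
    e3K_eq_neg_sum_push₃ hK hm L hS' hδ' κ' u', reslot_add, reslot_add, reslot_add, reslot_add,
    push₃_add hl hr hr hm (locStencil_reslot hS _ _) (locStencil_reslot hS' _ _) hδ hδ' κ' u',
    push₃_add hl hrm hr hm (locStencil_reslot hS _ _) (locStencil_reslot hS' _ _) hδ hδ' κ' u',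
    push₃_add hlm hr hr hm (locStencil_reslot hS _ _) (locStencil_reslot hS' _ _) hδ hδ' κ' u',
    push₃_add hlm hrm hr hm (locStencil_reslot hS _ _) (locStencil_reslot hS' _ _) hδ hδ' κ' u']
  ring

end Summit.QuantumFields.BalabanUV.Beta.GAN24.SrecLinearPartEq

end
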